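import Mathlib.LinearAlgebra.Matrix.SpecialLinearGroup
import Mathlib.LinearAlgebra.Projectivization.Basic
import Mathlib.GroupTheory.Coset.Basic
import Literature.NumberTheory.Automorphic.UnitaryGroupDoubledSiegelGeneration
import HarnessLib

/-!
# The rank-one doubled unitary group is `SL₂` (I): `SU(τ, antidiag(1,1)) = D · SL₂ · D⁻¹` over every base

Topic `NumberTheory/Automorphic`; namespace `Literature.NumberTheory.Automorphic.DoubledUnitary` (grouping sub-namespace
`RankOneSL2`).  KERNEL only: proved theorems, no definition, no named fact, no `sorry`.

Setting: the SPLIT MODEL of the doubled hermitian plane at RANK ONE — a commutative ring `S` with a ring endomorphism `τ`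
(the conjugation of a quadratic algebra `S ⊇ R`, `τ|_R = id`), an invertible `δ ∈ S` with `τ δ = −δ` (a «`√d`»), and the
`τ`-hermitian form `J₁ = !![0, 1; 1, 0]` on `S²` (the tree's `antidiagForm 1` on `Fin 1 ⊕ Fin 1`, re-enumerated on `Fin 2`:
`submatrix_antidiag_eq_antidiagForm_one`), with unitary group `U = unitaryGroupOfForm τ J₁ ≤ GL₂(S)`
(`UnitaryGroupAutomorphicRep`) and Siegel parabolic `P` = the block-upper elements (`g₁₀ = 0`; supplied by the consumer as a
`Subgroup` with this membership criterion).

MAIN RESULTS (the group theory that turns the rank-one Siegel Eisenstein series on the doubled unitary group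
`H□ = U(W ⊕ W⁻)`, `dim_E W = 1`, into an `SL₂`-Eisenstein series over the BASE field — [GelbartRogawski1991, §3];
[Kudla1994, §3]; [Weil1965, n° 39 (30)]; the exceptional isomorphism `SU(1,1)_{E∕F} ≅ SL_{2,F}` of [PlatonovRapinchuk1994, §2.3]).
This is file (I) of two (GENERIC: any commutative rings `f : R → S`, `τ ∘ f = f`, `τ δ = −δ`); the sequel
`DoubledUnitaryRankOneProjectiveLine` (II) does the field-level consequences (`U = M · φ(SL₂)` by Hilbert 90, `P \ U ≃ ℙ¹(F)`).
* §0 the bridge `!![0,1;1,0].submatrix e e = antidiagForm 1` (`e = finSumFinEquiv`), so ★ `unitaryGroupOfFormReindex` ∕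
  `unitaryGroupOfFormCongr` (`UnitaryGroupFormTransport`; Cayley, ★ `UnitaryGroupDoubledSiegelBruhat` §4) move every statement
  to any tree spelling of the doubled form;
* §1 `φ_δ(g) = D g D⁻¹`, `D = diag(1, δ)`: for `g = !![a,b;c,d] ∈ SL₂(R)` the matrix `!![f a, f b · δ⁻¹; δ · f c, f d]` is
  `τ`-unitary for `J₁` (`conjDiag_unitary`), whence a homomorphism `φ : SL₂(R) →* U(τ, J₁)(S)` with these values
  (`exists_sl2Hom` — stated as an existence so that no definition is introduced; consumers `obtain ⟨φ, hφ⟩` once), of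
  determinant one (`det_sl2Hom`), injective when `f` is (`sl2Hom_injective`);
* §2 **`range φ = SU`** (`mem_range_sl2Hom_iff_det_eq_one`): a `τ`-unitary `x` of determinant `1` has `τ`-FIXED entries
  `x₀₀, x₁₁` and `τ`-ANTIFIXED `x₀₁, x₁₀` (`fixed_entries_of_mem_of_det_eq_one` — four `linear_combination`s of the
  unitarity relations `unitarity_apply` with the determinant), so it is `φ g` as soon as `f` is injective onto the `τ`-fixed
  subring.  No involutivity of `τ`, no field, no `2 ≠ 0` is needed in this file.

Written for the Hodge-CM cell `pub/hodgecm-mathlib`, floor 0, E-2 child line `F0_E2SiegelWeilWeilRange` of crux H413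
(stmt-HodgeConjecture-24833), piece (1) ALG of the SW2a dossier (A-p16 (g17), 2026-08-31; F0P4-plan (g3) word 00:24:30Z).
Companion (cited, not restated): ★ `UnitaryGroupDoubledSiegelOrbit` (F0P4-p08: `P_Δ \ H ≃ U(W) = E¹` in the diagonal model
`S ⊕ −S`; the two models are Cayley-conjugate, ★ `UnitaryGroupDoubledSiegelBruhat` §4).  HC_CM is proved only modulo the
printed citations until rung 0 closes; this file discharges none of them.

## References
* [PlatonovRapinchuk1994] V. Platonov, A. Rapinchuk, *Algebraic Groups and Number Theory* (1994), §2.3 (unitary groups of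
  hermitian forms over quadratic extensions; the quasi-split `SU₂` is `SL₂`).
* [GelbartRogawski1991] S. Gelbart, J. Rogawski, *L-functions and Fourier–Jacobi coefficients for the unitary group U(3)*,
  Invent. Math. 105 (1991), §3 (the quasi-split `U(1,1)` and its Siegel parabolic).
* [Kudla1994] S. S. Kudla, Israel J. Math. 87 (1994) 361–401, §3.
* [Weil1965] A. Weil, Acta Math. 113 (1965) 1–87, n° 39 (30) (the Eisenstein–Siegel series as a sum over `P(k)\G(k)`).
-/

set_option autoImplicit false

noncomputable section

open scoped Matrix MatrixGroups
open Matrix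

namespace Literature.NumberTheory.Automorphic

namespace DoubledUnitary

namespace RankOneSL2

/-! ## §0 The split form `J₁ = !![0,1;1,0]` is the tree's `antidiagForm 1` re-enumerated on `Fin 2` -/

section Bridge

variable {K : Type*} [Field K]

/-- `!![0,1;1,0].submatrix finSumFinEquiv finSumFinEquiv = antidiagForm 1` on `Fin 1 ⊕ Fin 1` — so
`unitaryGroupOfFormReindex τ finSumFinEquiv !![0,1;1,0] : U(τ, antidiagForm 1) ≃ₜ* U(τ, !![0,1;1,0])`
(`UnitaryGroupFormTransport`) moves every statement of this file to the tree's split model `antidiagForm` of the doubled space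
`𝔻 = Δ ⊕ Δ⁻` ([Kudla1994, §3], as in ★ `UnitaryGroupDoubledSiegelBruhat`). [cite: Kudla1994, §3] -/
theorem submatrix_antidiag_eq_antidiagForm_one :
    (!![(0 : K), 1; 1, 0] : Matrix (Fin 2) (Fin 2) K).submatrix (finSumFinEquiv (m := 1) (n := 1))
      (finSumFinEquiv (m := 1) (n := 1)) = antidiagForm (1 : Matrix (Fin 1) (Fin 1) K) := by
  ext i j
  rcases i with i | i <;> rcases j with j | j <;> fin_cases i <;> fin_cases j <;> rfl

/-- The same bridge in `reindex` form: `reindex e e (antidiagForm 1) = !![0,1;1,0]`, `e = finSumFinEquiv`. [cite: Kudla1994, §3] -/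
theorem reindex_antidiagForm_one :
    Matrix.reindex (finSumFinEquiv (m := 1) (n := 1)) (finSumFinEquiv (m := 1) (n := 1))
      (antidiagForm (1 : Matrix (Fin 1) (Fin 1) K)) = !![(0 : K), 1; 1, 0] := by
  rw [← submatrix_antidiag_eq_antidiagForm_one, Matrix.reindex_apply, Matrix.submatrix_submatrix]
  simp

end Bridge

/-! ## §1 `φ_δ : SL₂(R) → U(τ, J₁)(S)`, `g ↦ D g D⁻¹` with `D = diag(1, δ)` -/

section Hom

variable {R S : Type*} [CommRing R] [CommRing S] (f : R →+* S) (τ : S →+* S) (δ : Sˣ)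

/-- `τ (δ⁻¹) = −δ⁻¹` when `τ δ = −δ`. [folklore] -/
private theorem map_units_inv_eq_neg (hδ : τ (δ : S) = -(δ : S)) : τ ((δ⁻¹ : Sˣ) : S) = -((δ⁻¹ : Sˣ) : S) := by
  have h1 : τ ((δ⁻¹ : Sˣ) : S) * τ (δ : S) = 1 := by
    rw [← map_mul, Units.inv_mul, map_one]
  rw [hδ, mul_neg, neg_eq_iff_eq_neg] at h1
  calc τ ((δ⁻¹ : Sˣ) : S) = τ ((δ⁻¹ : Sˣ) : S) * ((δ : S) * ((δ⁻¹ : Sˣ) : S)) := by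
        rw [Units.mul_inv, mul_one]
    _ = -((δ⁻¹ : Sˣ) : S) := by rw [← mul_assoc, h1]; ring

/-- THE UNITARITY COMPUTATION: for `a d − b c = 1` in `R` (and `τ ∘ f = f`, `τ δ = −δ`) the matrix
`M = !![f a, f b · δ⁻¹; δ · f c, f d]` satisfies `(τ M)ᵀ J₁ M = J₁`, `J₁ = !![0,1;1,0]`. [cite: PlatonovRapinchuk1994, §2.3] -/
theorem conjDiag_unitary (hτf : ∀ r, τ (f r) = f r) (hδ : τ (δ : S) = -(δ : S)) {a b c d : R} (hdet : a * d - b * c = 1) :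
    ((!![f a, f b * ((δ⁻¹ : Sˣ) : S); (δ : S) * f c, f d] : Matrix (Fin 2) (Fin 2) S).map τ)ᵀ * !![(0 : S), 1; 1, 0] *
        !![f a, f b * ((δ⁻¹ : Sˣ) : S); (δ : S) * f c, f d] = !![(0 : S), 1; 1, 0] := by
  have hdet' : f a * f d - f b * f c = 1 := by
    rw [← map_mul, ← map_mul, ← map_sub, hdet, map_one]
  have hδi : (δ : S) * ((δ⁻¹ : Sˣ) : S) = 1 := Units.mul_inv δ
  have hτi := map_units_inv_eq_neg τ δ hδ
  ext i j
  fin_cases i <;> fin_cases j <;>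
    simp [Matrix.mul_apply, Fin.sum_univ_two, Matrix.map_apply, hτf, hδ, hτi] <;>
    first
    | ring1
    | linear_combination hdet' - f b * f c * hδi


/-- **The homomorphism `φ_δ : SL₂(R) →* U(τ, J₁)(S)`, `g ↦ D g D⁻¹` (`D = diag(1, δ)`)**, stated as the existence of a
monoid homomorphism with the prescribed matrix entries `!![a, b δ⁻¹; δ c, d]` (so that no definition is introduced; consumers
`obtain ⟨φ, hφ⟩` once and feed `hφ` to the lemmas below). [cite: PlatonovRapinchuk1994, §2.3] -/
theorem exists_sl2Hom (hτf : ∀ r, τ (f r) = f r) (hδ : τ (δ : S) = -(δ : S)) :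
    ∃ φ : SL(2, R) →* unitaryGroupOfForm τ (!![(0 : S), 1; 1, 0] : Matrix (Fin 2) (Fin 2) S),
      ∀ g : SL(2, R), (((φ g : unitaryGroupOfForm τ (!![(0 : S), 1; 1, 0] : Matrix (Fin 2) (Fin 2) S)) :
        GL (Fin 2) S) : Matrix (Fin 2) (Fin 2) S) =
          !![f (g 0 0), f (g 0 1) * ((δ⁻¹ : Sˣ) : S); (δ : S) * f (g 1 0), f (g 1 1)] := by
  set J : Matrix (Fin 2) (Fin 2) S := !![(0 : S), 1; 1, 0] with hJ
  let M : SL(2, R) → Matrix (Fin 2) (Fin 2) S := fun g =>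
    !![f (g 0 0), f (g 0 1) * ((δ⁻¹ : Sˣ) : S); (δ : S) * f (g 1 0), f (g 1 1)]
  have hδi : (δ : S) * ((δ⁻¹ : Sˣ) : S) = 1 := Units.mul_inv δ
  have hM1 : M 1 = 1 := by
    ext i j
    fin_cases i <;> fin_cases j <;> simp [M]
  have hMmul : ∀ g h : SL(2, R), M (g * h) = M g * M h := by
    intro g h
    ext i j
    fin_cases i <;> fin_cases j <;>
      simp [M, Matrix.mul_apply, Fin.sum_univ_two, Matrix.SpecialLinearGroup.coe_mul] <;>
      first
      | ring1
      | linear_combination (-(f (g 0 1) * f (h 1 0))) * hδi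
      | linear_combination (-(f (g 1 0) * f (h 0 1))) * hδi
  let u : SL(2, R) →* GL (Fin 2) S :=
    { toFun := fun g => ⟨M g, M g⁻¹, by rw [← hMmul, mul_inv_cancel, hM1], by rw [← hMmul, inv_mul_cancel, hM1]⟩
      map_one' := by ext : 1; exact hM1
      map_mul' := fun g h => by ext : 1; exact hMmul g h }
  have hu : ∀ g, u g ∈ unitaryGroupOfForm τ J := fun g => by
    rw [mem_unitaryGroupOfForm_iff]
    have hdet : g 0 0 * g 1 1 - g 0 1 * g 1 0 = 1 := by
      have := g.det_coe
      rw [Matrix.det_fin_two] at this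
      exact this
    exact conjDiag_unitary f τ δ hτf hδ hdet
  exact ⟨u.codRestrict _ hu, fun g => rfl⟩

variable {f τ δ}
variable {φ : SL(2, R) →* unitaryGroupOfForm τ (!![(0 : S), 1; 1, 0] : Matrix (Fin 2) (Fin 2) S)}
  (hφ : ∀ g : SL(2, R), (((φ g : unitaryGroupOfForm τ (!![(0 : S), 1; 1, 0] : Matrix (Fin 2) (Fin 2) S)) :
    GL (Fin 2) S) : Matrix (Fin 2) (Fin 2) S) =
      !![f (g 0 0), f (g 0 1) * ((δ⁻¹ : Sˣ) : S); (δ : S) * f (g 1 0), f (g 1 1)])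
include hφ

/-- `det (φ g) = 1`: `φ` lands in the special unitary group. [cite: PlatonovRapinchuk1994, §2.3] -/
theorem det_sl2Hom (g : SL(2, R)) :
    Matrix.det (((φ g : unitaryGroupOfForm τ (!![(0 : S), 1; 1, 0] : Matrix (Fin 2) (Fin 2) S)) : GL (Fin 2) S) :
      Matrix (Fin 2) (Fin 2) S) = 1 := by
  have hdet : f (g 0 0) * f (g 1 1) - f (g 0 1) * f (g 1 0) = 1 := by
    have := g.det_coe
    rw [Matrix.det_fin_two] at this
    rw [← map_mul, ← map_mul, ← map_sub, this, map_one]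
  have hδi : (δ : S) * ((δ⁻¹ : Sˣ) : S) = 1 := Units.mul_inv δ
  rw [hφ, Matrix.det_fin_two]
  simp only [Matrix.of_apply, Matrix.cons_val', Matrix.cons_val_zero, Matrix.cons_val_one,
    Matrix.cons_val_fin_one, Matrix.empty_val']
  linear_combination hdet - f (g 0 1) * f (g 1 0) * hδi

/-- `φ` is injective when `f : R → S` is. [cite: PlatonovRapinchuk1994, §2.3] -/
theorem sl2Hom_injective (hinj : Function.Injective f) : Function.Injective φ := by
  intro g h hgh
  have hm := congrArg (fun x : unitaryGroupOfForm τ (!![(0 : S), 1; 1, 0] : Matrix (Fin 2) (Fin 2) S) =>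
    ((x : GL (Fin 2) S) : Matrix (Fin 2) (Fin 2) S)) hgh
  simp only [hφ] at hm
  have e := fun i j => congr_fun (congr_fun hm i) j
  have e00 := e 0 0; have e01 := e 0 1; have e10 := e 1 0; have e11 := e 1 1
  simp only [Matrix.of_apply, Matrix.cons_val', Matrix.cons_val_zero, Matrix.cons_val_one,
    Matrix.cons_val_fin_one, Matrix.empty_val'] at e00 e01 e10 e11
  have e01' : f (g 0 1) = f (h 0 1) := by
    simpa [mul_assoc, Units.inv_mul_cancel_right] using congrArg (· * (δ : S)) e01
  have e10' : f (g 1 0) = f (h 1 0) := by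
    simpa [← mul_assoc] using congrArg (((δ⁻¹ : Sˣ) : S) * ·) e10
  apply Matrix.SpecialLinearGroup.ext
  intro i j
  fin_cases i <;> fin_cases j
  · exact hinj e00
  · exact hinj e01'
  · exact hinj e10'
  · exact hinj e11

end Hom

/-! ## §2 The image of `φ_δ` is the special unitary group -/

section Image

variable {S : Type*} [CommRing S] {τ : S →+* S}

/-- The four UNITARITY RELATIONS of `x ∈ U(τ, !![0,1;1,0])` entrywise: `τ(x₁ᵢ) x₀ⱼ + τ(x₀ᵢ) x₁ⱼ = J₁ᵢⱼ`
(the defining equation `(τ x)ᵀ J₁ x = J₁` of `U(τ, J₁)`). [cite: PlatonovRapinchuk1994, §2.3] -/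
theorem unitarity_apply {x : GL (Fin 2) S}
    (hx : x ∈ unitaryGroupOfForm τ (!![(0 : S), 1; 1, 0] : Matrix (Fin 2) (Fin 2) S)) (i j : Fin 2) :
    τ ((x : Matrix (Fin 2) (Fin 2) S) 1 i) * (x : Matrix (Fin 2) (Fin 2) S) 0 j +
      τ ((x : Matrix (Fin 2) (Fin 2) S) 0 i) * (x : Matrix (Fin 2) (Fin 2) S) 1 j =
        (!![(0 : S), 1; 1, 0] : Matrix (Fin 2) (Fin 2) S) i j := by
  have h := congr_fun (congr_fun (mem_unitaryGroupOfForm_iff.1 hx) i) j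
  simpa [Matrix.mul_apply, Fin.sum_univ_two, Matrix.map_apply] using h

/-- **A `τ`-unitary matrix of determinant one has `τ`-fixed diagonal and `τ`-antifixed off-diagonal entries**:
`τ x₀₀ = x₀₀`, `τ x₁₁ = x₁₁`, `τ x₀₁ = −x₀₁`, `τ x₁₀ = −x₁₀` (each a linear combination of two unitarity relations and the
determinant; e.g. `τx₀₀ − x₀₀ = x₀₀·E₀₁ − x₀₁·E₀₀ − τx₀₀·(det − 1)`).  This is `SU(τ, J₁) ⊆ D · SL₂(S^τ) · D⁻¹`.
[cite: PlatonovRapinchuk1994, §2.3] -/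
theorem fixed_entries_of_mem_of_det_eq_one {x : GL (Fin 2) S}
    (hx : x ∈ unitaryGroupOfForm τ (!![(0 : S), 1; 1, 0] : Matrix (Fin 2) (Fin 2) S))
    (hdet : Matrix.det (x : Matrix (Fin 2) (Fin 2) S) = 1) :
    τ ((x : Matrix (Fin 2) (Fin 2) S) 0 0) = (x : Matrix (Fin 2) (Fin 2) S) 0 0 ∧
      τ ((x : Matrix (Fin 2) (Fin 2) S) 1 1) = (x : Matrix (Fin 2) (Fin 2) S) 1 1 ∧
      τ ((x : Matrix (Fin 2) (Fin 2) S) 0 1) = -(x : Matrix (Fin 2) (Fin 2) S) 0 1 ∧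
      τ ((x : Matrix (Fin 2) (Fin 2) S) 1 0) = -(x : Matrix (Fin 2) (Fin 2) S) 1 0 := by
  set H : Matrix (Fin 2) (Fin 2) S := (x : Matrix (Fin 2) (Fin 2) S) with hH
  have E00 := unitarity_apply hx 0 0
  have E01 := unitarity_apply hx 0 1
  have E10 := unitarity_apply hx 1 0
  have E11 := unitarity_apply hx 1 1
  simp only [← hH, Matrix.of_apply, Matrix.cons_val', Matrix.cons_val_zero, Matrix.cons_val_one,
    Matrix.cons_val_fin_one, Matrix.empty_val'] at E00 E01 E10 E11
  rw [Matrix.det_fin_two] at hdet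
  refine ⟨?_, ?_, ?_, ?_⟩
  · linear_combination H 0 0 * E01 - H 0 1 * E00 - τ (H 0 0) * hdet
  · linear_combination H 1 1 * E10 - H 1 0 * E11 - τ (H 1 1) * hdet
  · linear_combination (-H 0 1) * E10 + H 0 0 * E11 - τ (H 0 1) * hdet
  · linear_combination (-H 1 0) * E01 + H 1 1 * E00 - τ (H 1 0) * hdet

variable {R : Type*} [CommRing R] {f : R →+* S} {δ : Sˣ}
variable {φ : SL(2, R) →* unitaryGroupOfForm τ (!![(0 : S), 1; 1, 0] : Matrix (Fin 2) (Fin 2) S)}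
  (hφ : ∀ g : SL(2, R), (((φ g : unitaryGroupOfForm τ (!![(0 : S), 1; 1, 0] : Matrix (Fin 2) (Fin 2) S)) :
    GL (Fin 2) S) : Matrix (Fin 2) (Fin 2) S) =
      !![f (g 0 0), f (g 0 1) * ((δ⁻¹ : Sˣ) : S); (δ : S) * f (g 1 0), f (g 1 1)])
include hφ

/-- **`range φ_δ = SU(τ, J₁)`**: when `f : R → S` is injective with image the `τ`-fixed subring and `τ δ = −δ`, a `τ`-unitary
`x` lies in the image of `φ_δ` iff `det x = 1` — i.e. `φ_δ : SL₂(R) ≃ SU(τ, J₁)(S)` (the exceptional isomorphism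
`SU(1,1)_{E∕F} ≅ SL_{2,F}` of the quasi-split unitary group in two variables, valid over every `F`-algebra `R`, `S = E ⊗_F R`).
[cite: PlatonovRapinchuk1994, §2.3] -/
theorem mem_range_sl2Hom_iff_det_eq_one (hinj : Function.Injective f) (hfix : ∀ s : S, τ s = s → ∃ r : R, f r = s)
    (hδ : τ (δ : S) = -(δ : S))
    (x : unitaryGroupOfForm τ (!![(0 : S), 1; 1, 0] : Matrix (Fin 2) (Fin 2) S)) :
    x ∈ φ.range ↔ Matrix.det (((x : unitaryGroupOfForm τ (!![(0 : S), 1; 1, 0] : Matrix (Fin 2) (Fin 2) S)) :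
      GL (Fin 2) S) : Matrix (Fin 2) (Fin 2) S) = 1 := by
  constructor
  · rintro ⟨g, rfl⟩
    exact det_sl2Hom hφ g
  · intro hdet
    set H : Matrix (Fin 2) (Fin 2) S := ((x : GL (Fin 2) S) : Matrix (Fin 2) (Fin 2) S) with hH
    obtain ⟨h00, h11, h01, h10⟩ := fixed_entries_of_mem_of_det_eq_one x.2 hdet
    have hτi := map_units_inv_eq_neg τ δ hδ
    have hδi : (δ : S) * ((δ⁻¹ : Sˣ) : S) = 1 := Units.mul_inv δ
    obtain ⟨a, ha⟩ := hfix (H 0 0) h00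
    obtain ⟨d, hd⟩ := hfix (H 1 1) h11
    obtain ⟨b, hb⟩ := hfix (H 0 1 * (δ : S)) (by rw [map_mul, h01, hδ]; ring)
    obtain ⟨c, hc⟩ := hfix (((δ⁻¹ : Sˣ) : S) * H 1 0) (by rw [map_mul, h10, hτi]; ring)
    have hdetR : a * d - b * c = 1 := by
      apply hinj
      rw [map_sub, map_mul, map_mul, ha, hd, hb, hc, map_one, ← hdet, hH, Matrix.det_fin_two]
      linear_combination (-(H 0 1 * H 1 0)) * hδi
    refine ⟨⟨!![a, b; c, d], by rw [Matrix.det_fin_two]; simpa using hdetR⟩, ?_⟩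
    apply Subtype.ext
    apply Units.ext
    rw [hφ]
    change _ = H
    ext i j
    fin_cases i <;> fin_cases j
    · simpa using ha
    · simp only [Matrix.of_apply, Matrix.cons_val', Matrix.cons_val_zero, Matrix.cons_val_one,
        Matrix.cons_val_fin_one, Matrix.empty_val']
      change f b * _ = H 0 1
      rw [hb, mul_assoc, hδi, mul_one]
    · simp only [Matrix.of_apply, Matrix.cons_val', Matrix.cons_val_zero, Matrix.cons_val_one,
        Matrix.cons_val_fin_one, Matrix.empty_val']
      change (δ : S) * f c = H 1 0
      rw [hc, ← mul_assoc, hδi, one_mul]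
    · simpa using hd

end Image

end RankOneSL2

end DoubledUnitary

end Literature.NumberTheory.Automorphic
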